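import Literature.NumberTheory.LFunctions.RodgersTaoGapsSchemaProofs
import Literature.NumberTheory.LFunctions.RodgersTaoLittleOCountProofs
import HarnessLib

/-!
# Rodgers–Tao 2020, Corollary 3.3 (52) uniformly in `t`, and (52) AS PRINTED, WITH CONTENT

Trunk T-ANT (`Literature/NumberTheory/LFunctions`). PROOFS ONLY: no definition, no named fact.
LINE 1 — LABEL: RH-FREE literature (Rodgers–Tao 2020, §3); bears_on LADDER-RH N-C/N-P
(COLUMN 3, DBN). WHAT THIS IS NOT: every statement here concerns the real zeros `x_j(t)` of `H_t`
at times `t` lying above a real-rooted time — vacuous for `ζ` at `t < 0` (the tree proves `Λ ≥ 0`,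
`rodgers_tao_holds`) and the Riemann hypothesis' business at `t = 0`; proving the printed chain
WITH CONTENT (instead of ex falso from `Λ ≥ 0`) certifies the source's derivation, it does not
move RH. Nothing in this file bears on the truth of RH.

## What is proved

B. Rodgers, T. Tao, *The de Bruijn–Newman constant is non-negative*, Forum Math. Pi 8 (2020) e6,
Corollary 10 (= arXiv v4 Corollary 3.3), eq. (52), p. 23: «We also have
`x_k(t) − x_j(t) = 4π(k − j)/log₊ ξ_j + o_{j→∞}(log₊ ξ_j)` whenever `1 ≤ j < k ≤ j + log²₊ ξ_j`»
(for `Λ < t ≤ 0`; proof in print: «Repeating the previous analysis», i.e. the short-interval count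
(49) of Theorem 9 between two enumerated zeros, as on pp. 21–22 for (44)–(47)).

* `RodgersTao2020.cor33_gaps_of_count_estimates_uniform` — rt-iso's RH-free schema
  `cor33_gaps_of_count_estimates` ((49) + (50) at `t` ⟹ (52) at `t`, `RodgersTaoGapsSchemaProofs.lean`)
  with the threshold quantified BEFORE `t`: for every location constant `B`, every (49)-threshold
  `T₁` (at `C = 16π`, accuracy `ε′ = min(1/2, ε/(32π))`) and every `ε > 0` there is ONE `j₀` such
  that at every time `t` above a real-rooted time, (50) with `B` and (49) beyond `T₁` give (52) with
  `ε` for all `j ≥ j₀`. (rt-iso's proof verbatim up to moving the existential — its `j₀` depends on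
  `B`, `T₁`, `ε` alone; a possibly negative `B` is replaced by `B⁺ = max B 0` in the thresholds.)
* `RodgersTao2020.cor33_gaps_inner (T₀)` — RH-FREE, over the kernel theorems, uniformly on
  `[−T₀, 0]`: `∀ ε>0 ∃ j₀ ∀ t ∈ [−T₀, 0]` above a real-rooted time `∀ j ≥ j₀ ∀ k`,
  `j < k ≤ j + log²₊ ξ_j ⇒ |x_k(t) − x_j(t) − 4π(k−j)/log₊ ξ_j| ≤ ε log₊ ξ_j`; from
  `cor33_location_inner` ((50), `RodgersTaoLocationUniformProofs.lean`) and `thm32_littleO_inner`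
  ((49), `RodgersTaoLittleOCountProofs.lean`). This is the `h52` hypothesis shape of the §7 schema
  theorems of the cell (`rodgers_tao_renormHamiltonian_decay_of`, `rodgers_tao_truncEnergy_lower_bound_of`)
  with ONE threshold on the whole time interval.
* `RodgersTao2020.cor33_gaps_content : cor33_gaps` — **(52) AS PRINTED, WITH CONTENT.** By
  Newman's theorem (`Λ > −∞`: `bddBelow_setOf_hasOnlyRealZeros_holds`) every time above a
  real-rooted time lies in one window `[L, 0]`, so the inner theorem gives the as-printed `sInf`-free
  statement with ONE threshold before `t`. So far the tree had only the EX-FALSO `cor33_gaps_holds`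
  (from `Λ ≥ 0`); the present proof follows the printed route (§2 asymptotics ⟹ (48), (49) ⟹ (50)
  ⟹ (52)) and makes no use of `Λ ≥ 0`. (Its hypothesis «`∃ t₁ < t`, `H_{t₁}` real-rooted, `t ≤ 0`»
  remains, of course, unsatisfiable for `ζ`.) With this file all four displays of Theorem 9 /
  Corollary 10, (48)–(52), are kernel theorems WITH CONTENT (`thm32_bigO_content`,
  `thm32_littleO_content`, `cor33_location_content`, `cor33_order_content`, `cor33_gaps_content`).

Not re-declared here (dedup rule; one line each over landed reductions, recorded for the reader):
Lemma 20 and Lemma 24 as printed WITH CONTENT are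
`rodgers_tao_renormHamiltonian_decay_of_cor33 cor33_location_content cor33_gaps_content`
(`RodgersTaoRenormHamiltonianDecayLeafProofs.lean`) and
`rodgers_tao_truncEnergy_lower_bound_of_cor33 cor33_location_content cor33_gaps_content`
(`RodgersTaoTruncEnergyLowerBoundProofs.lean`).

## References

* B. Rodgers, T. Tao, *The de Bruijn–Newman constant is non-negative*, Forum Math. Pi 8 (2020),
  e6 = arXiv:1801.05914: Theorem 9 (49) p. 23, Corollary 10 (50), (52) p. 23 («Repeating the
  previous analysis»), the (44)–(47) deduction pp. 21–22. [RodgersTaoFMP2020]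
* C. M. Newman, *Fourier transforms with only real zeros*, Proc. AMS 61 (1976), Thm. 3 (`Λ > −∞`).
  [Newman1976]
-/

noncomputable section

open Real Set Filter Topology

namespace Literature.NumberTheory.LFunctions

namespace RodgersTao2020

set_option maxHeartbeats 400000 in
/-- **Corollary 3.3, eq. (52), RH-FREE schema with the threshold quantified BEFORE `t`.** For
every `B`, `T₁` and `ε > 0` there is `j₀` such that at every time `t` above a real-rooted time, the
(50)-shape location law `|x_j(t) − ξ_j| ≤ B log₊ ξ_j` (`j ≥ 1`) together with the (49)-shape count
`|N_t([T, T + α log₊ T]) − α log²₊ T/(4π)| ≤ ε′ log²₊ T` for `0 ≤ α ≤ 16π`, `T ≥ T₁`,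
`ε′ = min(1/2, ε/(32π))`, imply the gap law (52)
`|x_k(t) − x_j(t) − 4π(k−j)/log₊ ξ_j| ≤ ε log₊ ξ_j` for `j₀ ≤ j < k ≤ j + log²₊ ξ_j`. The proof is
rt-iso's `cor33_gaps_of_count_estimates` (`RodgersTaoGapsSchemaProofs.lean`: exact count
`N_t([x_j, x_k]) = k − j + 1`, (49) at `T = x_j(t)` with `α* = (x_k − x_j)/log₊ x_j ≤ 16π`, and
`log₊ x_j = (1 + o(1)) log₊ ξ_j` from (50)) with the existential moved in front of `t` — its `j₀`
depends on `B⁺ = max B 0`, `T₁`, `ε` alone.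
[cite: RodgersTaoFMP2020, Corollary 3.3 = Corollary 10 eq. (52) p.23 (deduction from (49), (50))] -/
theorem cor33_gaps_of_count_estimates_uniform (B T₁ : ℝ) {ε : ℝ} (hε : 0 < ε) :
    ∃ j₀ : ℕ, ∀ t : ℝ, (∃ t₁ : ℝ, t₁ < t ∧ HasOnlyRealZeros (deBruijnH t₁)) →
      (∀ j : ℕ, 1 ≤ j →
        |deBruijnZero t j - classicalLocation (j : ℝ)| ≤ B * logPlus (classicalLocation (j : ℝ))) →
      (∀ α : ℝ, 0 ≤ α → α ≤ 16 * π → ∀ T : ℝ, T₁ ≤ T →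
        |(deBruijnZeroCount t (Icc T (T + α * logPlus T)) : ℝ) - α * logPlus T ^ 2 / (4 * π)| ≤
          min (1 / 2) (ε / (32 * π)) * logPlus T ^ 2) →
      ∀ j k : ℕ, j₀ ≤ j → j < k → (k : ℝ) ≤ j + logPlus (classicalLocation (j : ℝ)) ^ 2 →
        |deBruijnZero t k - deBruijnZero t j -
            4 * π * ((k : ℝ) - j) / logPlus (classicalLocation (j : ℝ))| ≤
          ε * logPlus (classicalLocation (j : ℝ)) := by
  have hπ := Real.pi_pos
  have hπ3 := Real.pi_gt_three
  -- `B⁺ = max B 0 ≥ 0`, so that all thresholds are defined before `t`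
  set B' : ℝ := max B 0 with hB'
  have hB0 : 0 ≤ B' := le_max_right _ _
  have hBB' : B ≤ B' := le_max_left _ _
  -- parameters
  set C : ℝ := 16 * π with hC
  have hC0 : 0 < C := by positivity
  set ε' : ℝ := min (1 / 2) (ε / (32 * π)) with hε'
  have hε'0 : 0 < ε' := lt_min (by norm_num) (by positivity)
  have hε'1 : ε' ≤ 1 / 2 := min_le_left _ _
  have hε'2 : ε' ≤ ε / (32 * π) := min_le_right _ _
  set δ : ℝ := min (1 / 20) (ε / (32 * π)) with hδ
  have hδ0 : 0 < δ := lt_min (by norm_num) (by positivity)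
  have hδ1 : δ ≤ 1 / 20 := min_le_left _ _
  have hδ2 : δ ≤ ε / (32 * π) := min_le_right _ _
  -- largeness conditions on `ξ = ξ_j`, pulled back along `ξ_j → ∞`
  have hev : ∀ᶠ ξ : ℝ in atTop, 4 * B' * Real.log (2 + ξ) ≤ ξ ∧ 2 * T₁ ≤ ξ ∧ 8 * π ≤ ξ ∧
      2 * B' ≤ δ * ξ ∧ 32 * π / ε ≤ Real.log (2 + ξ) ^ 2 := by
    have hA : ∀ᶠ ξ : ℝ in atTop, 4 * B' * Real.log (2 + ξ) ≤ ξ := by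
      rcases eq_or_lt_of_le hB0 with hB | hB
      · filter_upwards [eventually_ge_atTop (0 : ℝ)] with ξ hξ
        rw [← hB]; simpa using hξ
      · filter_upwards [eventually_log_two_add_le_mul (show 0 < 1 / (4 * B') by positivity)]
          with ξ hξ
        have := mul_le_mul_of_nonneg_left hξ (show 0 ≤ 4 * B' by positivity)
        calc 4 * B' * Real.log (2 + ξ) ≤ 4 * B' * (1 / (4 * B') * ξ) := this
          _ = ξ := by field_simp
    have hD : ∀ᶠ ξ : ℝ in atTop, 32 * π / ε ≤ Real.log (2 + ξ) ^ 2 := by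
      have hlog : Tendsto (fun ξ : ℝ ↦ Real.log (2 + ξ)) atTop atTop :=
        Real.tendsto_log_atTop.comp (tendsto_atTop_add_const_left _ _ tendsto_id)
      have hsq : Tendsto (fun ξ : ℝ ↦ Real.log (2 + ξ) ^ 2) atTop atTop :=
        (tendsto_pow_atTop two_ne_zero).comp hlog
      exact hsq.eventually_ge_atTop _
    filter_upwards [hA, eventually_ge_atTop (2 * T₁), eventually_ge_atTop (8 * π),
      eventually_ge_atTop (2 * B' / δ), hD] with ξ h1 h2 h3 h4 h5
    refine ⟨h1, h2, h3, ?_, h5⟩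
    rw [div_le_iff₀ hδ0] at h4
    exact h4.trans_eq (mul_comm _ _)
  obtain ⟨j₁, hj₁⟩ := eventually_atTop.1 (tendsto_classicalLocation_natCast.eventually hev)
  refine ⟨max j₁ 1, fun t hΛ h50 h49 j k hj hjk hk ↦ ?_⟩
  have hj1 : 1 ≤ j := le_trans (le_max_right _ _) hj
  have hk1 : 1 ≤ k := hj1.trans hjk.le
  obtain ⟨hAξ, hTξ, h8π, hBδ, hΛε⟩ := hj₁ j (le_trans (le_max_left _ _) hj)
  -- notation
  set ξ : ℝ := classicalLocation (j : ℝ) with hξdef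
  set x : ℝ := deBruijnZero t j with hxdef
  set y : ℝ := deBruijnZero t k with hydef
  set Λ : ℝ := logPlus ξ with hΛdef
  set L : ℝ := logPlus x with hLdef
  have hξ0 : 0 < ξ := by linarith
  have hΛ0 : 0 < Λ := logPlus_pos ξ
  have hL0 : 0 < L := logPlus_pos x
  have hΛeq : Λ = Real.log (2 + ξ) := logPlus_of_nonneg hξ0.le
  have hΛ2 : 0.69 ≤ Λ := by
    have h1 := log_two_le_logPlus ξ
    have h2 := Real.log_two_gt_d9
    rw [← hΛdef] at h1
    linarith
  have hΛsq : 0.4761 ≤ Λ ^ 2 := by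
    have := pow_le_pow_left₀ (by norm_num) hΛ2 2
    norm_num at this
    linarith
  have hδΛ : δ * Λ ≤ 1 / 20 * Λ := mul_le_mul_of_nonneg_right hδ1 hΛ0.le
  -- (50) at `j`: `x` is within `B⁺Λ ≤ ξ/4` of `ξ`
  have h50j : |x - ξ| ≤ B' * Λ :=
    (h50 j hj1).trans (mul_le_mul_of_nonneg_right hBB' hΛ0.le)
  have hBΛ : B' * Λ ≤ ξ / 4 := by rw [hΛeq]; linarith
  have hxlo : ξ / 2 ≤ x := by linarith [(abs_le.1 (h50j.trans hBΛ)).1]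
  have hxhi : x ≤ 2 * ξ := by linarith [(abs_le.1 (h50j.trans hBΛ)).2]
  have hx0 : 0 < x := by linarith
  have hxT : T₁ ≤ x := by linarith
  -- `|L − Λ| ≤ δ Λ`
  have hLΛ : |L - Λ| ≤ δ * Λ := by
    have h1 := abs_logPlus_sub_logPlus_le hx0.le hξ0 hxlo
    rw [← hLdef, ← hΛdef] at h1
    calc |L - Λ| ≤ 2 * |x - ξ| / ξ := h1
      _ ≤ 2 * (B' * Λ) / ξ := by gcongr
      _ = (2 * B') / ξ * Λ := by ring
      _ ≤ (δ * ξ) / ξ * Λ := by gcongr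
      _ = δ * Λ := by field_simp
  have hLge : (19 / 20) * Λ ≤ L := by
    have := (abs_le.1 hLΛ).1
    linarith
  have hLlo : Λ / 2 ≤ L := by linarith
  have hLhi : L ≤ 2 * Λ := by
    have := (abs_le.1 hLΛ).2
    linarith
  have hL2lo : (19 / 20) ^ 2 * Λ ^ 2 ≤ L ^ 2 := by
    calc (19 / 20) ^ 2 * Λ ^ 2 = ((19 / 20) * Λ) ^ 2 := by ring
      _ ≤ L ^ 2 := pow_le_pow_left₀ (by positivity) hLge 2
  -- the gap in units of `L`
  have hxy : x < y := strictMono_deBruijnZero hΛ hjk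
  set n : ℝ := (k : ℝ) - j with hndef
  have hn1 : 1 ≤ n := by
    rw [hndef]
    have : (j : ℝ) + 1 ≤ k := by exact_mod_cast hjk
    linarith
  have hnΛ : n ≤ Λ ^ 2 := by rw [hndef]; linarith
  -- the exact count between `x_j` and `x_k`
  have hcount : (deBruijnZeroCount t (Icc x y) : ℝ) = n + 1 := by
    rw [hxdef, hydef, deBruijnZeroCount_Icc_deBruijnZero_deBruijnZero hΛ hj1, hndef]
    have : j ≤ k + 1 := by omega
    push_cast [Nat.cast_sub this]
    ring
  -- Step A: `y ≤ x + C L` (else (49) at `α = C` puts too many zeros in `[x, x + CL] ⊆ [x, y]`)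
  have hyC : y ≤ x + C * L := by
    by_contra hgt
    push Not at hgt
    have hmono := deBruijnZeroCount_Icc_mono_right t x hgt.le
    have hle : (deBruijnZeroCount t (Icc x (x + C * L)) : ℝ) ≤ n + 1 := by
      rw [← hcount]; exact_mod_cast hmono
    have h49C := h49 C hC0.le le_rfl x hxT
    rw [← hLdef] at h49C
    have hge : C * L ^ 2 / (4 * π) - ε' * L ^ 2 ≤
        (deBruijnZeroCount t (Icc x (x + C * L)) : ℝ) := by
      have := (abs_le.1 h49C).1; linarith
    have hCL : C * L ^ 2 / (4 * π) = 4 * L ^ 2 := by rw [hC]; field_simp; ring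
    rw [hCL] at hge
    -- `(4 − ε') L² ≥ 3.5 L² ≥ 3.5·(19/20)² Λ² > Λ² + 1 ≥ n + 1`
    have h1 : (7 / 2) * L ^ 2 ≤ 4 * L ^ 2 - ε' * L ^ 2 := by
      have := mul_le_mul_of_nonneg_right hε'1 (sq_nonneg L)
      linarith
    have h2 : Λ ^ 2 + 1 < (7 / 2) * ((19 / 20) ^ 2 * Λ ^ 2) := by
      norm_num
      linarith
    have h3 : (7 / 2) * ((19 / 20) ^ 2 * Λ ^ 2) ≤ (7 / 2) * L ^ 2 := by linarith
    linarith
  -- Step B: (49) at `α* = (y − x)/L ∈ [0, C]`, `T = x`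
  set α : ℝ := (y - x) / L with hαdef
  have hα0 : 0 ≤ α := div_nonneg (by linarith) hL0.le
  have hαC : α ≤ C := by rw [hαdef, div_le_iff₀ hL0]; linarith
  have hαL : x + α * L = y := by rw [hαdef]; field_simp; ring
  have h49α := h49 α hα0 hαC x hxT
  rw [← hLdef, hαL, hcount] at h49α
  -- `|y − x − 4π(n+1)/L| ≤ 4π ε' L`
  have hB1 : |(y - x) - 4 * π * (n + 1) / L| ≤ 4 * π * ε' * L := by
    have e : (y - x) - 4 * π * (n + 1) / L = -(4 * π / L) * ((n + 1) - α * L ^ 2 / (4 * π)) := by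
      rw [hαdef]; field_simp; ring
    rw [e, abs_mul, abs_neg, abs_of_pos (by positivity : 0 < 4 * π / L)]
    calc 4 * π / L * |n + 1 - α * L ^ 2 / (4 * π)| ≤ 4 * π / L * (ε' * L ^ 2) :=
          mul_le_mul_of_nonneg_left h49α (by positivity)
      _ = 4 * π * ε' * L := by field_simp
  -- Step C: change `(n+1)/L` into `n/Λ`
  have hC1 : |4 * π * (n + 1) / L - 4 * π * n / Λ| ≤
      4 * π / L + 4 * π * n * (δ * Λ) / (L * Λ) := by
    have e : 4 * π * (n + 1) / L - 4 * π * n / Λ =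
        4 * π / L + 4 * π * n * (Λ - L) / (L * Λ) := by
      field_simp; ring
    rw [e]
    calc |4 * π / L + 4 * π * n * (Λ - L) / (L * Λ)|
        ≤ |4 * π / L| + |4 * π * n * (Λ - L) / (L * Λ)| := abs_add_le _ _
      _ = 4 * π / L + 4 * π * n * |Λ - L| / (L * Λ) := by
          rw [abs_of_pos (by positivity : 0 < 4 * π / L), abs_div, abs_mul,
            abs_of_pos (by positivity : 0 < 4 * π * n), abs_of_pos (by positivity : 0 < L * Λ)]
      _ ≤ 4 * π / L + 4 * π * n * (δ * Λ) / (L * Λ) := by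
          rw [abs_sub_comm] at hLΛ
          gcongr
  -- the three error terms are each `≤ (ε/4, ε/4, ε/2) · Λ`
  have hT1 : 4 * π * ε' * L ≤ ε / 4 * Λ := by
    calc 4 * π * ε' * L ≤ 4 * π * (ε / (32 * π)) * (2 * Λ) := by gcongr
      _ = ε / 4 * Λ := by field_simp; ring
  have hT2 : 4 * π / L ≤ ε / 4 * Λ := by
    -- `4π/L ≤ 8π/Λ ≤ (ε/4)·Λ`: use `Λ² ≥ 32π/ε` and `L ≥ Λ/2`
    rw [div_le_iff₀ hL0]
    have h1 : 32 * π ≤ ε * Λ ^ 2 := by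
      have := (div_le_iff₀ hε).1 hΛε
      rw [← hΛeq] at this
      linarith
    have h2 : ε / 4 * Λ * (Λ / 2) ≤ ε / 4 * Λ * L :=
      mul_le_mul_of_nonneg_left hLlo (by positivity)
    have h3 : ε / 4 * Λ * (Λ / 2) = ε * Λ ^ 2 / 8 := by ring
    linarith
  have hT3 : 4 * π * n * (δ * Λ) / (L * Λ) ≤ ε / 2 * Λ := by
    rw [div_le_iff₀ (by positivity)]
    have h1 : 4 * π * n * (δ * Λ) ≤ 4 * π * Λ ^ 2 * ((ε / (32 * π)) * Λ) := by
      have : n * δ ≤ Λ ^ 2 * (ε / (32 * π)) :=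
        mul_le_mul hnΛ hδ2 hδ0.le (by positivity)
      have h0 : 0 ≤ 4 * π * Λ := by positivity
      calc 4 * π * n * (δ * Λ) = 4 * π * Λ * (n * δ) := by ring
        _ ≤ 4 * π * Λ * (Λ ^ 2 * (ε / (32 * π))) := mul_le_mul_of_nonneg_left this h0
        _ = 4 * π * Λ ^ 2 * ((ε / (32 * π)) * Λ) := by ring
    have h2 : 4 * π * Λ ^ 2 * ((ε / (32 * π)) * Λ) = ε * Λ ^ 2 * Λ / 8 := by field_simp; ring
    have h3 : ε * Λ ^ 2 / 2 * (Λ / 2) ≤ ε * Λ ^ 2 / 2 * L :=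
      mul_le_mul_of_nonneg_left hLlo (by positivity)
    have h4 : ε / 2 * Λ * (L * Λ) = ε * Λ ^ 2 / 2 * L := by ring
    have h5 : 0 ≤ ε * Λ ^ 2 * Λ := by positivity
    rw [h4]
    linarith
  -- assemble
  have hfin : |y - x - 4 * π * n / Λ| ≤ ε * Λ := by
    calc |y - x - 4 * π * n / Λ|
        = |((y - x) - 4 * π * (n + 1) / L) + (4 * π * (n + 1) / L - 4 * π * n / Λ)| := by
          congr 1; ring
      _ ≤ |(y - x) - 4 * π * (n + 1) / L| + |4 * π * (n + 1) / L - 4 * π * n / Λ| :=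
          abs_add_le _ _
      _ ≤ 4 * π * ε' * L + (4 * π / L + 4 * π * n * (δ * Λ) / (L * Λ)) := add_le_add hB1 hC1
      _ ≤ ε / 4 * Λ + (ε / 4 * Λ + ε / 2 * Λ) := add_le_add hT1 (add_le_add hT2 hT3)
      _ = ε * Λ := by ring
  exact hfin

/-- **Corollary 3.3, eq. (52) — RH-FREE, over the kernel theorems, uniformly on `[−T₀, 0]`.**
For every `T₀` and `ε > 0` there is `j₀` such that for every `t ∈ [−T₀, 0]` above a real-rooted
time and all `j₀ ≤ j < k ≤ j + log²₊ ξ_j`, `|x_k(t) − x_j(t) − 4π(k − j)/log₊ ξ_j| ≤ ε log₊ ξ_j`.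
This is the `h52` hypothesis shape of the §7 schema theorems (`rodgers_tao_renormHamiltonian_decay_of`,
`rodgers_tao_truncEnergy_lower_bound_of`) with ONE threshold on the whole interval:
`cor33_location_inner` ((50), `RodgersTaoLocationUniformProofs.lean`) and `thm32_littleO_inner`
((49) at `C = 16π`, `RodgersTaoLittleOCountProofs.lean`) fed into
`cor33_gaps_of_count_estimates_uniform`. [cite: RodgersTaoFMP2020, Corollary 3.3 = Corollary 10 eq. (52) p.23] -/
theorem cor33_gaps_inner (T₀ : ℝ) :
    ∀ ε : ℝ, 0 < ε → ∃ j₀ : ℕ,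
      ∀ t ∈ Icc (-T₀) 0, (∃ t₁ : ℝ, t₁ < t ∧ HasOnlyRealZeros (deBruijnH t₁)) →
        ∀ j k : ℕ, j₀ ≤ j → j < k → (k : ℝ) ≤ j + logPlus (classicalLocation (j : ℝ)) ^ 2 →
          |deBruijnZero t k - deBruijnZero t j -
              4 * π * ((k : ℝ) - j) / logPlus (classicalLocation (j : ℝ))| ≤
            ε * logPlus (classicalLocation (j : ℝ)) := by
  intro ε hε
  have hπ := Real.pi_pos
  obtain ⟨B, hB⟩ := cor33_location_inner T₀
  obtain ⟨T₁, hT₁⟩ := thm32_littleO_inner T₀ (16 * π) (by positivity)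
    (min (1 / 2) (ε / (32 * π))) (lt_min (by norm_num) (by positivity))
  obtain ⟨j₀, hj₀⟩ := cor33_gaps_of_count_estimates_uniform B T₁ hε
  exact ⟨j₀, fun t ht hΛ ↦ hj₀ t hΛ (hB t ht hΛ) fun α hα0 hαC T hT ↦ hT₁ t ht hΛ α hα0 hαC T hT⟩

/-- **Corollary 3.3 (52) AS PRINTED, WITH CONTENT.** The as-printed named fact `cor33_gaps`
(`∀ ε > 0, ∃ j₀, ∀ t` above a real-rooted time with `t ≤ 0`, `∀ j₀ ≤ j < k ≤ j + log²₊ ξ_j`,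
`|x_k(t) − x_j(t) − 4π(k−j)/log₊ ξ_j| ≤ ε log₊ ξ_j`) — so far only EX FALSO in the tree
(`cor33_gaps_holds`, from `Λ ≥ 0`) — proved along the printed route: the set of real-rooted times
is bounded below (Newman 1976, `bddBelow_setOf_hasOnlyRealZeros_holds`), so every admissible `t`
lies in one compact window `[L, 0]`, on which `cor33_gaps_inner` gives a uniform threshold. No use
of `Λ ≥ 0`. [cite: RodgersTaoFMP2020, Corollary 3.3 = Corollary 10 eq. (52) p.23] -/
theorem cor33_gaps_content : cor33_gaps := by
  intro ε hε
  obtain ⟨L, hL⟩ := bddBelow_setOf_hasOnlyRealZeros_holds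
  obtain ⟨j₀, hj₀⟩ := cor33_gaps_inner (-L) ε hε
  refine ⟨j₀, fun t hΛ ht0 j k hj hjk hk ↦ hj₀ t ⟨?_, ht0⟩ hΛ j k hj hjk hk⟩
  obtain ⟨t₁, ht₁, hr⟩ := hΛ
  have := hL hr
  linarith

end RodgersTao2020

end Literature.NumberTheory.LFunctions

end
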